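import Literature.MathematicalPhysics.QuantumFieldTheory.Balaban1983to89.B9B8KnitBondTransfer
import Literature.MathematicalPhysics.QuantumFieldTheory.Balaban1983to89.B9Eq3132Ineq2142Covariant
import Literature.MathematicalPhysics.QuantumFieldTheory.Balaban1983to89.B9Eq316AveragingTransposeZd

/-!
# `Balaban1983to89.B9B8KnitBondAvgDictionary` — the (B)-line bond junction, file c2 (part I): THE BOND-AVERAGING DICTIONARY — def-Y's flat averaging
# kernel `qK` (r03's one-stroke weight `q_ι(f) = L^{-j(d+2)}·#{(x ∈ B^j(ι₋), t < L^j) : [x+te_μ, x+(t+1)e_μ] = f}`, [3] (1.18)) IS `L^{-j}` TIMES THE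
# [Balaban1985Averaging] KNIT's FLAT COMPOSITE LINEAR AVERAGING `linQIter` ((127) at `U₀ = 1`, one-stroke form `linQIter_eq_linQ_pow`) READ ON THE
# PERIODIC LIFT: `(LʲQ_j(1) a♯)(z, μ) = Lʲ·Σ_f q_ι(f)·a(f)` for the index bond `ι = ⟨j, ⟨0 + z, μ⟩⟩`

statement-level skeleton of published theorems with citation tags; proofs where landed; nothing here is a claim about the
Yang–Mills mass gap

Sub-row G-B8-T2S (unit `lit-balaban-t2s-1`, gen 7), RULING #10 road, crux (c′) = the averaging closeness (design `lit-balaban-t2s-1/g7/BLINE-DESIGN-g7.md` §3).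
def-Y's `Q(U) = trLiftY qK (qT parB U)` ([4] (3.12); `Node00.OpsYDeltaA.QY`) has the flat kernel `qK ι f = q_ι(f)` (`B9Eq3132Ineq2142Covariant.qK_apply`,
`B6Ineq2142KLevelV1.qwt_eq_sum`); the knit's genuine averaging letter is built on `B7Prop4GeneralLevels.linCovIter L U₀ · j` («LʲQ_j(U₀)»), which at
`U₀ = 1` is `B7Prop4Flat.linQIter` (this file, `linCovIter_one_eq_linQIter`), in one-stroke form `Σ_{r ∈ [0,Lʲ)^{d+1}} (Lʲ)^{-(d+1)}·Σ_{i<Lʲ} B(Lʲz + r + ie_μ, μ)`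
(`linQIter_eq_linQ_pow`, `linQ_eq_sum`).  On the periodic lift `a♯` of a member bond function ([B8] p. 77 «Ω_j = T_η»; `B9B8KnitBondTransfer.liftBd`) the two
one-stroke sums are the SAME sum: the fine sites `0 + (Lʲz + r)` are exactly the V1 block `B^j(0 + z)` (`B5Eq118OneStroke.mem_iterBlock_iff`, the period
`2L^{m+K} = Lʲ·2L^{m+K−j}`), and `x + te_μ` is `LatticeFieldCalculus.runSite`.  Print: [3] (1.18) p. 20; [5] (125), (127) pp. 36–37; [4] (3.12) p. 392; [B8] p. 77.

WHAT IS PROVED (kernel, 0 sorry; theorems only, no `def`, no `… : Prop` fact, no `instance`).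
* §1 torus charts: `sitesPerDir_zero_eq_mul` (`P₀ = Lʲ·P_j`), `val_transl_zero` (`val (0 + w)_μ = w_μ mod P`), ★ `val_transl_boxVec` (`val((0 + (Lʲz + r))_μ) = Lʲ·val((0 + z)_μ) + r_μ`),
  ★ `transl_boxVec_mem_iterBlock`, ★ `transl_boxVec_of_mem_iterBlock` (every `x ∈ B^j(0 + z)` is `0 + (Lʲz + r)` with `r_μ = val(x_μ) mod Lʲ`),
  `runSite_transl` (`(0 + w) + te_μ = 0 + (w + te_μ)`).
* §2 ★★★ `linQIter_liftBd_eq_sum_qK` — THE DICTIONARY: for every index bond `ι` (level `j = j(ι)`, direction `μ`) and every `z ∈ ℤ^{d+1}` over its source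
  (`0 + z = ι₋` on `T^{(j)}`): `linQIter L (a♯) j z μ = Lʲ·Σ_f qK ι f·a(f)`; hence ★★ `linQIter_liftBd_eq_QY_one` (`= Lʲ·(Q(1)a)(ι)`, def-Y's `QY` at the trivial
  transporters).
* §3 ★ `linCovIter_one_eq_linQIter` — the knit's composite linear averaging at `U₀ = 1` IS `linQIter` (bounded fields; `linQcov_one_left`, `avgIter_one`).

HONEST SCOPE.  Flat dictionary only (no transporters, no estimate); the curved comparison (c4–c6 of the design) is NOT here; count-neutral; nothing continuum ∕
ℝ⁴ ∕ OS ∕ mass gap ∕ Clay — the Yang–Mills mass gap is NOT proved here.  NEW file; r03's `qwt`, p38's `qK_apply`, the V1 ∕ torus charts and [5]'s flat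
averaging files are used BY NAME, nothing landed is modified.
-/

noncomputable section

namespace Literature.MathematicalPhysics.QuantumFieldTheory.Balaban1983to89.B9B8KnitBondAvgDictionary

open scoped BigOperators
open Node00
open B7Prop1Explicit renaming Site → LSite
open B7Prop1Explicit (e e_apply boxVec)
open B6KLevelCensusIndexV1 (KIdx)
open B6GlobalChartV1 (PV)
open B6Ineq2142KLevelV1 (qwt qwt_eq_sum cQ lvl)
open B5Eq118OneStroke (iterBlock iterBlockOf mem_iterBlock mem_iterBlock_iff)
open B7Prop4Flat (linQIter linQIter_eq_linQ_pow linQ_eq_sum norm_linQIter_le)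
open B7Prop3Flat (linQ)
open B7Prop3GeneralLinear (linQcov linQcov_one_left)
open B7Prop4GeneralLevels (linCovIter linCovIter_succ)
open B7Prop2Explicit (avgIter)
open B7Eq92Concrete (avgIter_one)
open LatticeFieldCalculus (runSite runBond)
open B10Eq27TorusAxialLog (transl transl_apply)
open B9B8KnitBondTransfer (liftBd liftBd_apply)
open B9Eq3132Ineq2142Covariant (qK_apply)

variable {d ℓ : ℕ} {hd : 1 ≤ d + 1} {hL : Odd (ℓ + 1) ∧ 1 < ℓ + 1} {b₀ b₁ : ℝ}

/-! ## §1 Torus charts: the fine sites over a coarse block -/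

section Charts

variable {m K : ℕ}

/-- `P₀ = Lʲ·P_j` for the V1 torus (`j ≤ m + K`). [cite: Balaban1984PropagatorsI, (1.6) p.18, bookkeeping] -/
theorem sitesPerDir_zero_eq_mul {j : ℕ} (hj : j ≤ m + K) :
    (PV d ℓ m K hd hL).sitesPerDir 0 = (ℓ + 1) ^ j * (PV d ℓ m K hd hL).sitesPerDir j := by
  show 2 * (ℓ + 1) ^ (m + K - 0) = (ℓ + 1) ^ j * (2 * (ℓ + 1) ^ (m + K - j))
  rw [Nat.sub_zero, mul_left_comm, ← pow_add, Nat.add_sub_cancel' hj]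

/-- the label of a translate of the origin: `val((0 + w)_μ) = w_μ mod P` (as an integer). [cite: Balaban1987RG1, (0.1) p.251, bookkeeping] -/
theorem val_transl_zero {j : ℕ} (w : LSite (d + 1)) (μ : Fin (d + 1)) :
    (((transl (0 : Site (PV d ℓ m K hd hL) j) w μ).val : ℕ) : ℤ) = w μ % ((PV d ℓ m K hd hL).sitesPerDir j : ℕ) := by
  rw [transl_apply, show (0 : Site (PV d ℓ m K hd hL) j) μ = 0 from rfl, zero_add, ZMod.val_intCast]

/-- [folklore] `(N·z + r) mod (N·P) = N·(z mod P) + r` for `0 ≤ r < N`, `0 < P`. -/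
private theorem emod_mul_add_eq {N P z r : ℤ} (hP : 0 < P) (hr0 : 0 ≤ r) (hrN : r < N) : (N * z + r) % (N * P) = N * (z % P) + r := by
  have hN : 0 < N := lt_of_le_of_lt hr0 hrN
  have hzP : P * (z / P) + z % P = z := Int.mul_ediv_add_emod z P
  have hlt : z % P < P := Int.emod_lt_of_pos z hP
  have hge : 0 ≤ z % P := Int.emod_nonneg z hP.ne'
  have hdecomp : N * z + r = (N * (z % P) + r) + (N * P) * (z / P) := by linear_combination (-N) * hzP
  rw [hdecomp, Int.add_mul_emod_self_left]
  refine Int.emod_eq_of_lt (by positivity) ?_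
  calc N * (z % P) + r < N * (z % P) + N := by linarith
    _ = N * (z % P + 1) := by ring
    _ ≤ N * P := mul_le_mul_of_nonneg_left (by omega) hN.le

/-- ★ the fine label of `0 + (Lʲz + r)`: `val = Lʲ·val((0 + z)_μ) + r_μ` (`r ∈ [0, Lʲ)^{d+1}`, `j ≤ m + K`). [cite: Balaban1984PropagatorsI, (1.6) p.18, bookkeeping] -/
theorem val_transl_boxVec {j : ℕ} (hj : j ≤ m + K) (z : LSite (d + 1)) (r : Fin (d + 1) → Fin ((ℓ + 1) ^ j)) (μ : Fin (d + 1)) :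
    (transl (0 : Site (PV d ℓ m K hd hL) 0) ((((ℓ + 1) ^ j : ℕ) : ℤ) • z + boxVec ((ℓ + 1) ^ j) r) μ).val =
      (ℓ + 1) ^ j * (transl (0 : Site (PV d ℓ m K hd hL) j) z μ).val + (r μ : ℕ) := by
  have hP : (0 : ℤ) < ((PV d ℓ m K hd hL).sitesPerDir j : ℕ) := by
    exact_mod_cast Nat.pos_of_ne_zero ((PV d ℓ m K hd hL).sitesPerDir_ne_zero j)
  have h0 := val_transl_zero (m := m) (K := K) (hd := hd) (hL := hL) (j := 0) ((((ℓ + 1) ^ j : ℕ) : ℤ) • z + boxVec ((ℓ + 1) ^ j) r) μ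
  have hj' := val_transl_zero (m := m) (K := K) (hd := hd) (hL := hL) (j := j) z μ
  have hP0 : (((PV d ℓ m K hd hL).sitesPerDir 0 : ℕ) : ℤ) = (((ℓ + 1) ^ j : ℕ) : ℤ) * (((PV d ℓ m K hd hL).sitesPerDir j : ℕ) : ℤ) := by
    rw [sitesPerDir_zero_eq_mul hj, Nat.cast_mul]
  rw [hP0] at h0
  simp only [Pi.add_apply, Pi.smul_apply, smul_eq_mul, boxVec] at h0
  rw [emod_mul_add_eq hP (by positivity) (by exact_mod_cast (r μ).2), ← hj'] at h0
  exact_mod_cast h0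

/-- ★ `0 + (Lʲz + r) ∈ B^j(0 + z)` for `r ∈ [0, Lʲ)^{d+1}`. [cite: Balaban1984PropagatorsI, (1.6) p.18] -/
theorem transl_boxVec_mem_iterBlock {j : ℕ} (hj : j ≤ m + K) (z : LSite (d + 1)) (r : Fin (d + 1) → Fin ((ℓ + 1) ^ j)) :
    transl (0 : Site (PV d ℓ m K hd hL) 0) ((((ℓ + 1) ^ j : ℕ) : ℤ) • z + boxVec ((ℓ + 1) ^ j) r) ∈
      iterBlock j (transl (0 : Site (PV d ℓ m K hd hL) j) z) := by
  rw [mem_iterBlock_iff (P := PV d ℓ m K hd hL) (by exact hj)]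
  intro μ
  show _ / (ℓ + 1) ^ j = _
  have hL0 : 0 < (ℓ + 1) ^ j := by positivity
  rw [val_transl_boxVec hj z r μ, Nat.mul_add_div hL0, Nat.div_eq_of_lt (r μ).2, add_zero]

/-- ★ every `x ∈ B^j(0 + z)` is `0 + (Lʲz + r)` with `r_μ = val(x_μ) mod Lʲ`. [cite: Balaban1984PropagatorsI, (1.6) p.18] -/
theorem transl_boxVec_of_mem_iterBlock {j : ℕ} (hj : j ≤ m + K) (z : LSite (d + 1)) {x : Site (PV d ℓ m K hd hL) 0}
    (hx : x ∈ iterBlock j (transl (0 : Site (PV d ℓ m K hd hL) j) z)) :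
    transl (0 : Site (PV d ℓ m K hd hL) 0) ((((ℓ + 1) ^ j : ℕ) : ℤ) • z +
        boxVec ((ℓ + 1) ^ j) (fun μ => ⟨(x μ).val % (ℓ + 1) ^ j, Nat.mod_lt _ (by positivity)⟩)) = x := by
  rw [mem_iterBlock_iff (P := PV d ℓ m K hd hL) (by exact hj)] at hx
  funext μ
  apply ZMod.val_injective
  rw [val_transl_boxVec hj z _ μ]
  have hxμ := hx μ
  change (x μ).val / (ℓ + 1) ^ j = _ at hxμ
  show (ℓ + 1) ^ j * (transl (0 : Site (PV d ℓ m K hd hL) j) z μ).val + (x μ).val % (ℓ + 1) ^ j = (x μ).val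
  rw [← hxμ, Nat.div_add_mod]

/-- `(0 + w) + te_μ = 0 + (w + te_μ)`: the straight run of `LatticeFieldCalculus.runSite` in the chart. [cite: Balaban1984PropagatorsI, (1.7) p.18, bookkeeping] -/
theorem runSite_transl {j : ℕ} (w : LSite (d + 1)) (μ : Fin (d + 1)) (t : ℕ) :
    runSite (transl (0 : Site (PV d ℓ m K hd hL) j) w) μ t = transl (0 : Site (PV d ℓ m K hd hL) j) (w + ((t : ℕ) : ℤ) • e μ) := by
  funext ν
  unfold runSite
  by_cases h : ν = μ
  · subst h
    rw [Function.update_self, transl_apply, transl_apply, Pi.add_apply, Pi.smul_apply, e_apply, if_pos rfl, smul_eq_mul, mul_one,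
      Int.cast_add, Int.cast_natCast, add_assoc]
  · rw [Function.update_of_ne h, transl_apply, transl_apply, Pi.add_apply, Pi.smul_apply, e_apply, if_neg h, smul_zero, add_zero]

end Charts

/-! ## §2 The dictionary: `LʲQ_j(1) a♯ = Lʲ·(Q(1)a)` entry by entry -/

section Dictionary

variable {𝔸 : Type} [NormedRing 𝔸] [NormedAlgebra ℂ 𝔸] (i : KIdx d ℓ hd hL b₀ b₁)

/-- [folklore] a kernel given by an indicator count collapses the sum: `Σ_f (Σ_{p∈s} [φ p = f])·g(f) = Σ_{p∈s} g(φ p)`. -/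
private theorem sum_count_smul_eq {X β : Type*} [Fintype X] [DecidableEq X] (s : Finset β) (φ : β → X) (g : X → 𝔸) :
    ∑ f, (((∑ p ∈ s, (if φ p = f then (1 : ℝ) else 0)) : ℝ) : ℂ) • g f = ∑ p ∈ s, g (φ p) := by
  simp_rw [Complex.ofReal_sum, Finset.sum_smul]
  rw [Finset.sum_comm]
  refine Finset.sum_congr rfl fun p _ => ?_
  rw [Finset.sum_eq_single (φ p)]
  · rw [if_pos rfl, Complex.ofReal_one, one_smul]
  · intro f _ hf
    rw [if_neg (Ne.symm hf), Complex.ofReal_zero, zero_smul]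
  · intro h
    exact absurd (Finset.mem_univ _) h

/-- ★★★ **THE BOND-AVERAGING DICTIONARY (flat)**: for an index bond `ι` of level `j` and direction `μ`, and any `z ∈ ℤ^{d+1}` with `0 + z = ι₋` on `T^{(j)}`,
the knit's flat composite linear averaging of the periodic lift at the coarse bond `(z, μ)` is `Lʲ` times def-Y's flat average:
`linQIter L (a♯) j z μ = Lʲ·Σ_f qK ι f·a(f)`. [cite: Balaban1984PropagatorsI, (1.18) p.20; Balaban1985Averaging, (125) p.36, (127) p.37; Balaban1985BackgroundPropagators, (3.12) p.392] -/
theorem linQIter_liftBd_eq_sum_qK (ι : IBondY i) (z : LSite (d + 1))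
    (hz : transl (0 : Site (PV d ℓ i.m i.K hd hL) (ι.1.1 : ℕ)) z = ι.1.2.src) (a : FBondY i → 𝔸) :
    linQIter (ℓ + 1) (liftBd i a) (ι.1.1 : ℕ) z ι.1.2.dir =
      (((((ℓ + 1 : ℕ) : ℝ)) ^ (ι.1.1 : ℕ) : ℝ) : ℂ) • ∑ f, ((qK i ι f : ℝ) : ℂ) • a f := by
  classical
  set j : ℕ := (ι.1.1 : ℕ) with hjdef
  set N : ℕ := (ℓ + 1) ^ j with hN
  set μ := ι.1.2.dir with hμ
  have hj : j ≤ i.m + i.K := B6Ineq2142KLevelV1.lvl_le_mK i.hN i.D i.hk ι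
  have hN0 : 0 < N := by positivity
  -- def-Y side: the one-stroke pair count
  have hY : ∑ f, ((qK i ι f : ℝ) : ℂ) • a f =
      ((cQ (d := d) (ℓ := ℓ) j : ℝ) : ℂ) • ∑ x ∈ iterBlock j ι.1.2.src, ∑ t ∈ Finset.range N, a (runBond x μ t) := by
    have hq : ∀ f, qK i ι f = cQ (d := d) (ℓ := ℓ) j *
        ∑ p ∈ iterBlock j ι.1.2.src ×ˢ Finset.range N, (if runBond p.1 μ p.2 = f then (1 : ℝ) else 0) := fun f => by
      rw [qK_apply, qwt_eq_sum, Finset.sum_product]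
    simp_rw [hq, Complex.ofReal_mul, mul_smul]
    rw [← Finset.smul_sum, sum_count_smul_eq, Finset.sum_product]
  -- knit side: the one-stroke block sum of the lift
  have hK : linQIter (ℓ + 1) (liftBd i a) j z μ =
      ∑ r : Fin (d + 1) → Fin N, (((N : ℝ) ^ (d + 1))⁻¹) • ∑ s : Fin N, a (runBond (transl (0 : Site (PV d ℓ i.m i.K hd hL) 0)
        (((N : ℕ) : ℤ) • z + boxVec N r)) μ s) := by
    rw [linQIter_eq_linQ_pow, linQ_eq_sum]
    refine Finset.sum_congr rfl fun r _ => ?_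
    congr 1
    refine Finset.sum_congr rfl fun s _ => ?_
    rw [liftBd_apply, runBond, runSite_transl]
  rw [hK, hY, ← Finset.smul_sum, smul_smul]
  -- the scalars: `Lʲ·cQ j = (Lʲ)^{-(d+1)}`
  have hscal : (((((ℓ + 1 : ℕ) : ℝ)) ^ j : ℝ) : ℂ) * ((cQ (d := d) (ℓ := ℓ) j : ℝ) : ℂ) = ((((N : ℝ) ^ (d + 1))⁻¹ : ℝ) : ℂ) := by
    rw [← Complex.ofReal_mul]
    congr 1
    rw [B6Ineq2142KLevelV1.cQ, hN, Nat.cast_pow, ← pow_mul, ← pow_mul, mul_comm (d + 1) j]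
    have hL0 : (((ℓ + 1 : ℕ) : ℝ)) ^ j ≠ 0 := by positivity
    field_simp
  rw [← Complex.coe_smul, ← hscal]
  congr 1
  -- the bijection `r ↦ 0 + (Lʲz + r)` between `[0, Lʲ)^{d+1}` and `B^j(ι₋)`
  rw [← hz]
  refine Finset.sum_bij' (fun r _ => transl (0 : Site (PV d ℓ i.m i.K hd hL) 0) (((N : ℕ) : ℤ) • z + boxVec N r))
    (fun x _ => fun ν => ⟨(x ν).val % N, Nat.mod_lt _ hN0⟩) (fun r _ => transl_boxVec_mem_iterBlock hj z r) (fun _ _ => Finset.mem_univ _)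
    (fun r _ => ?_) (fun x hx => transl_boxVec_of_mem_iterBlock hj z hx) (fun r _ => ?_)
  · funext ν
    apply Fin.ext
    show (transl (0 : Site (PV d ℓ i.m i.K hd hL) 0) (((N : ℕ) : ℤ) • z + boxVec N r) ν).val % N = r ν
    rw [val_transl_boxVec hj z r ν, Nat.mul_add_mod, Nat.mod_eq_of_lt (r ν).2]
  · rw [← Fin.sum_univ_eq_sum_range]

/-- ★★ **THE SAME, AS def-Y's `Q(1)`**: `linQIter L (a♯) j z μ = Lʲ·(Q(1)a)(ι)` with `Q(1) = QY parB 1` (trivial transporters; any `parB`).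
[cite: Balaban1985BackgroundPropagators, (3.12) p.392; Balaban1985Averaging, (127) p.37] -/
theorem linQIter_liftBd_eq_QY_one [CompleteSpace 𝔸] (parB : BondParY 𝔸 i) (hpar : ∀ z w, parB (fun _ _ => (1 : 𝔸ˣ)) z w = 1) (ι : IBondY i) (z : LSite (d + 1))
    (hz : transl (0 : Site (PV d ℓ i.m i.K hd hL) (ι.1.1 : ℕ)) z = ι.1.2.src) (a : FBondY i → 𝔸) :
    linQIter (ℓ + 1) (liftBd i a) (ι.1.1 : ℕ) z ι.1.2.dir =
      (((((ℓ + 1 : ℕ) : ℝ)) ^ (ι.1.1 : ℕ) : ℝ) : ℂ) • QY i parB (fun _ _ => (1 : 𝔸ˣ)) a ι := by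
  rw [linQIter_liftBd_eq_sum_qK i ι z hz a, QY, trLiftY_apply]
  congr 1
  refine Finset.sum_congr rfl fun f _ => ?_
  rw [qT, hpar, B9Eq39Adjoint.R_one]

end Dictionary

/-! ## §3 The knit's composite linear averaging at the trivial background -/

section Flat

variable {𝔸 : Type} [NormedRing 𝔸] [NormOneClass 𝔸] [NormedAlgebra ℂ 𝔸] [CompleteSpace 𝔸]

/-- ★ **AT `U₀ = 1` THE COMPOSITE LINEAR AVERAGING IS THE FLAT ITERATE**: `linCovIter L 1 B j = linQIter L B j` for bounded `B` (every `Ū₀ʲ = 1`,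
`avgIter_one`; the one-step linear part at `V₀ = 1` is `linQ`, `linQcov_one_left`). [cite: Balaban1985Averaging, (127) p.37, (122) + (125) p.36] -/
theorem linCovIter_one_eq_linQIter {dd L : ℕ} (hL : 1 ≤ L) (B : B7Prop1Explicit.Site dd → Fin dd → 𝔸) {b : ℝ} (hb : 0 ≤ b)
    (hB : ∀ x κ, ‖B x κ‖ ≤ b) : ∀ j : ℕ, linCovIter L (1 : B7Prop1Explicit.Site dd → Fin dd → 𝔸ˣ) B j = linQIter L B j
  | 0 => rfl
  | j + 1 => by
    funext z κ
    rw [linCovIter_succ, B7Prop4Flat.linQIter_succ, avgIter_one, linCovIter_one_eq_linQIter hL B hb hB j]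
    exact linQcov_one_left L hL _ (by positivity) (norm_linQIter_le L hL B hb hB j) _ _

end Flat

end Literature.MathematicalPhysics.QuantumFieldTheory.Balaban1983to89.B9B8KnitBondAvgDictionary
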